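import Mathlib.FieldTheory.AlgebraicClosure
import Mathlib.FieldTheory.IsAlgClosed.Classification
import Mathlib.SetTheory.Cardinal.Subfield
import Literature.NumberTheory.Transcendental.GammaIsoTransfer
import Literature.NumberTheory.Transcendental.LindemannWeierstrassProofs
import HarnessLib

/-!
# A countable algebraically closed subfield of `ℂ` of infinite transcendence degree containing `2πi`

The ambient field of the ω-chain construction of a countable pseudo-exponential field
(`PseudoExpChain*.lean`; Kirby, *Finitely presented exponential fields*, Algebra & Number Theory 7
(2013), §§2–3: the countable ELA-fields with standard kernel and the Schanuel property obtained by
adjoining, one at a time, exponentials, logarithms and generic points of rotund varieties; Bays–Kirby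
2018, Thm 5.9 for the amalgamation version): a subfield `Ω ⊆ ℂ` which is

* countable,
* algebraically closed, indeed relatively algebraically closed in `ℂ` (`acl Ω ⊆ Ω` in the
  algebraic matroid of `ℂ` over `ℚ`), so that roots `exp(q · log y)`, `y ∈ Ω`, `q ∈ ℚ`, stay in `Ω`,
* contains `2πi` (the kernel generator of the complex exponential), and
* has *room*: no finite subset spans it in the algebraic matroid — for every finite `S ⊆ ℂ` there is
  `t ∈ Ω` transcendental over `ℚ(S)`.

Construction: `2πi` is transcendental (Lindemann), so `{2πi}` extends to a transcendence basis `T` of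
`ℂ/ℚ`, which has cardinality `𝔠` (`IsAlgClosed.cardinal_eq_cardinal_transcendence_basis_of_aleph0_lt'`);
take a countably infinite `B ⊆ T` containing `2πi` and let `Ω` be the algebraic closure in `ℂ` of
`ℚ(B)` (Mathlib's `algebraicClosure`).

## Contents

* `PseudoExpAmbient.exists_ambient` — the subfield `Ω` with the four properties (room in `ℂ`).
* `PseudoExpAmbient.acl_eq_preimage` — the algebraic matroid of `↥Ω` is the restriction of that
  of `ℂ` (`MatroidComap.algebraicIndependent_matroid_eq_comap`), whence room inside `↥Ω`
  (`exists_ambient'`).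

## References

* J. Kirby, *Finitely presented exponential fields*, Algebra & Number Theory 7 (2013) 943–980,
  §§2–3 (ELA-closure, adjoining generic points of varieties).
* M. Bays, J. Kirby, *Pseudo-exponential maps, variants, and quasiminimality*, Algebra & Number
  Theory 12 (2018), Thm 5.9.
-/

noncomputable section

open Cardinal Set
open scoped Cardinal

namespace Literature.NumberTheory.Transcendental

namespace PseudoExpAmbient

open GammaField

/-! ### Transport of algebraicity between subrings of `ℂ` -/

/-- Algebraicity over a `ℚ`-subalgebra `S ⊆ ℂ` implies algebraicity over any intermediate field
`T ⊇ S` (map the polynomial along the inclusion). [folklore] -/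
theorem isAlgebraic_of_subset {S : Subalgebra ℚ ℂ} {T : IntermediateField ℚ ℂ}
    (h : (S : Set ℂ) ⊆ T) {x : ℂ} (hx : IsAlgebraic S x) : IsAlgebraic T x := by
  obtain ⟨p, hp0, hpx⟩ := hx
  let f : S →+* T :=
    { toFun := fun y => ⟨y, h y.2⟩
      map_one' := rfl
      map_mul' := fun _ _ => rfl
      map_zero' := rfl
      map_add' := fun _ _ => rfl }
  have hf : Function.Injective f := fun a b hab =>
    Subtype.ext (congrArg Subtype.val hab :)
  have hcomp : (algebraMap T ℂ).comp f = algebraMap S ℂ := RingHom.ext fun _ => rfl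
  refine ⟨p.map f, fun h0 => hp0 ((Polynomial.map_eq_zero_iff hf).1 h0), ?_⟩
  rw [Polynomial.aeval_def, Polynomial.eval₂_map, hcomp, ← Polynomial.aeval_def]
  exact hpx

/-- An element algebraic over an intermediate field `T ⊆ ℂ` lies in `acl T`. [folklore] -/
theorem mem_acl_of_isAlgebraic {T : IntermediateField ℚ ℂ} {x : ℂ} (hx : IsAlgebraic T x) :
    x ∈ acl (T : Set ℂ) := by
  rw [mem_acl_iff]
  have hadj : Algebra.adjoin ℚ (T : Set ℂ) = T.toSubalgebra := Algebra.adjoin_eq T.toSubalgebra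
  rw [hadj]
  exact hx

/-- `2πi` is transcendental over `ℚ` (Lindemann: `π` is transcendental, `transcendental_pi_holds`;
`π = 2πi · i · (-2)⁻¹`). [cite: Lindemann1882] -/
theorem transcendental_twoPiI : Transcendental ℚ (2 * Real.pi * Complex.I : ℂ) := by
  intro h
  have hI : IsAlgebraic ℚ Complex.I := by
    refine ⟨Polynomial.X ^ 2 + 1, Polynomial.Monic.ne_zero (by monicity!), ?_⟩
    simp
  have h2 : IsAlgebraic ℚ ((-2 : ℤ) : ℂ)⁻¹ := (isAlgebraic_int (-2)).inv
  have hpi : IsAlgebraic ℚ (Real.pi : ℂ) := by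
    have e : (Real.pi : ℂ) = 2 * Real.pi * Complex.I * Complex.I * ((-2 : ℤ) : ℂ)⁻¹ := by
      rw [mul_assoc (2 * (Real.pi : ℂ)), Complex.I_mul_I]
      push_cast
      ring
    rw [e]
    exact (h.mul hI).mul h2
  exact transcendental_pi_holds
    ((isAlgebraic_algebraMap_iff (A := ℂ) Complex.ofReal_injective).mp hpi)

/-- A countably infinite `ℚ`-algebraically independent subset of `ℂ` containing `2πi`: part of a
transcendence basis of `ℂ/ℚ` through `2πi`, which is uncountable. [folklore] -/
theorem exists_indep_countable :
    ∃ B : Set ℂ, (2 * Real.pi * Complex.I : ℂ) ∈ B ∧ B.Countable ∧ B.Infinite ∧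
      AlgebraicIndepOn ℚ _root_.id B := by
  classical
  have hind : AlgebraicIndepOn ℚ _root_.id ({(2 * Real.pi * Complex.I : ℂ)} : Set ℂ) :=
    (algebraicIndependent_singleton_iff
      (⟨_, mem_singleton _⟩ : ({(2 * Real.pi * Complex.I : ℂ)} : Set ℂ))).2 transcendental_twoPiI
  obtain ⟨T, hcT, hT⟩ := exists_isTranscendenceBasis_superset hind
  -- `#T = 𝔠`, so `T` is infinite
  have hTcard : #ℂ = #T :=
    IsAlgClosed.cardinal_eq_cardinal_transcendence_basis_of_aleph0_lt' ((↑) : T → ℂ) hT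
      Cardinal.mk_le_aleph0 (by rw [Cardinal.mk_complex]; exact Cardinal.aleph0_lt_continuum)
  haveI : Infinite T := by
    rw [← Cardinal.aleph0_le_mk_iff, ← hTcard, Cardinal.mk_complex]
    exact Cardinal.aleph0_le_continuum
  let e : ℕ ↪ T := Infinite.natEmbedding T
  refine ⟨insert (2 * Real.pi * Complex.I : ℂ) (range fun n => (e n : ℂ)), mem_insert _ _,
    (countable_range _).insert _, ?_, ?_⟩
  · refine Set.Infinite.mono (subset_insert _ _) (infinite_range_of_injective ?_)
    intro m n hmn
    exact e.injective (Subtype.ext hmn)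
  · refine AlgebraicIndependent.mono ?_ hT.1
    rintro x (rfl | ⟨n, rfl⟩)
    · exact hcT (mem_singleton _)
    · exact (e n).2

/-! ### The algebraic closure of `ℚ(B)` inside `ℂ` -/

section Amb

variable (K₀ : IntermediateField ℚ ℂ)

/-- Membership in the subfield `(algebraicClosure K₀ ℂ).toSubfield` (written `amb K₀` in the
docstrings below): integrality over `K₀`. [folklore] -/
theorem mem_amb_iff {x : ℂ} : x ∈ (algebraicClosure K₀ ℂ).toSubfield ↔ IsIntegral K₀ x := by
  rw [IntermediateField.mem_toSubfield, mem_algebraicClosure_iff']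

/-- `K₀ ⊆ amb K₀`. [folklore] -/
theorem le_amb {x : ℂ} (hx : x ∈ K₀) : x ∈ (algebraicClosure K₀ ℂ).toSubfield := by
  rw [mem_amb_iff]
  exact isIntegral_algebraMap (x := (⟨x, hx⟩ : K₀))

set_option synthInstance.maxHeartbeats 200000 in
/-- `amb K₀` is algebraically closed. [folklore] -/
theorem isAlgClosed_amb : IsAlgClosed (algebraicClosure K₀ ℂ).toSubfield := by
  have h : IsAlgClosed (algebraicClosure K₀ ℂ) := IsAlgClosure.isAlgClosed K₀
  exact h

set_option synthInstance.maxHeartbeats 200000 in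
/-- `amb K₀` is countable when `K₀` is. [folklore] -/
theorem countable_amb (h : #K₀ ≤ ℵ₀) : Countable (algebraicClosure K₀ ℂ).toSubfield := by
  have hΩ : #(algebraicClosure K₀ ℂ) ≤ max #K₀ ℵ₀ :=
    Algebra.IsAlgebraic.cardinalMk_le_max K₀ (algebraicClosure K₀ ℂ)
  have : #(algebraicClosure K₀ ℂ).toSubfield ≤ ℵ₀ := (hΩ.trans (max_le h le_rfl) :)
  exact Cardinal.mk_le_aleph0_iff.1 this

/-- `amb K₀ ⊆ acl K₀`: its elements are algebraic over `K₀`. [folklore] -/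
theorem amb_subset_acl : (((algebraicClosure K₀ ℂ).toSubfield : Subfield ℂ) : Set ℂ) ⊆ acl (K₀ : Set ℂ) := by
  intro y hy
  have hy' : IsIntegral K₀ y := (mem_amb_iff K₀).1 hy
  exact mem_acl_of_isAlgebraic hy'.isAlgebraic

/-- `acl K₀ ⊆ amb K₀`: complex numbers algebraic over `ℚ(K₀) = K₀` are integral over `K₀`.
[folklore] -/
theorem acl_subset_amb : acl (K₀ : Set ℂ) ⊆ (((algebraicClosure K₀ ℂ).toSubfield : Subfield ℂ) : Set ℂ) := by
  intro x hx
  rw [mem_acl_iff] at hx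
  have hsub : ((Algebra.adjoin ℚ (K₀ : Set ℂ) : Subalgebra ℚ ℂ) : Set ℂ) ⊆ K₀ := by
    intro y hy
    exact (Algebra.adjoin_le (S := K₀.toSubalgebra) fun z hz => hz) hy
  have hx' : IsAlgebraic K₀ x := isAlgebraic_of_subset hsub hx
  exact (mem_amb_iff K₀).2 hx'.isIntegral

/-- `amb K₀` is `acl`-closed in `ℂ`. [folklore] -/
theorem acl_amb_subset {x : ℂ} (hx : x ∈ acl (((algebraicClosure K₀ ℂ).toSubfield : Subfield ℂ) : Set ℂ)) :
    x ∈ (algebraicClosure K₀ ℂ).toSubfield := by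
  have h1 : acl (((algebraicClosure K₀ ℂ).toSubfield : Subfield ℂ) : Set ℂ) ⊆ acl (K₀ : Set ℂ) :=
    acl_subset_acl_of_subset (amb_subset_acl K₀)
  exact acl_subset_amb K₀ (h1 hx)

end Amb

/-- **The ambient field.** A countable, algebraically closed subfield `Ω ⊆ ℂ` containing `2πi`,
closed under `acl` (every complex number algebraic over `ℚ(Ω)` lies in `Ω`) and with room: for
every finite `S ⊆ ℂ` some element of `Ω` is transcendental over `ℚ(S)`. [folklore] -/
theorem exists_ambient :
    ∃ Ω : Subfield ℂ, Countable Ω ∧ IsAlgClosed Ω ∧ (2 * Real.pi * Complex.I : ℂ) ∈ Ω ∧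
      (∀ x : ℂ, x ∈ acl (Ω : Set ℂ) → x ∈ Ω) ∧
      (∀ S : Set ℂ, S.Finite → ∃ t ∈ Ω, t ∉ acl S) := by
  classical
  obtain ⟨B, hcB, hBc, hBinf, hB⟩ := exists_indep_countable
  refine ⟨(algebraicClosure (IntermediateField.adjoin ℚ B) ℂ).toSubfield, countable_amb _ ?_,
    isAlgClosed_amb _,
    le_amb _ (IntermediateField.subset_adjoin ℚ B hcB), fun x hx => acl_amb_subset _ hx, ?_⟩
  · -- `ℚ(B)` is countable
    have h1 : ((IntermediateField.adjoin ℚ B : IntermediateField ℚ ℂ) : Set ℂ) =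
        Subfield.closure (Set.range (algebraMap ℚ ℂ) ∪ B) := by
      rw [← IntermediateField.coe_toSubfield, IntermediateField.adjoin_toSubfield]
    have h2 : #(IntermediateField.adjoin ℚ B) = #(Subfield.closure (Set.range (algebraMap ℚ ℂ) ∪ B)) :=
      Cardinal.mk_congr (Equiv.setCongr h1)
    rw [h2]
    refine le_trans (Subfield.cardinalMk_closure_le_max _) (max_le ?_ le_rfl)
    rw [Cardinal.mk_le_aleph0_iff]
    exact ((countable_range _).union hBc).to_subtype
  · -- room: `B ⊆ Ω` is an infinite independent set, so it is not spanned by a finite `S`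
    intro S hS
    by_contra hcon
    push Not at hcon
    have hBΩ : B ⊆ (((algebraicClosure (IntermediateField.adjoin ℚ B) ℂ).toSubfield : Subfield ℂ) : Set ℂ) :=
      fun b hb => le_amb _ (IntermediateField.subset_adjoin ℚ B hb)
    have hBS : B ⊆ acl S := fun b hb => hcon b (hBΩ hb)
    have hind : (algMatroid ℂ).Indep B := AlgebraicIndependent.matroid_indep_iff.2 hB
    have h1 : (algMatroid ℂ).eRk B ≤ (algMatroid ℂ).eRk S := by
      rw [← (algMatroid ℂ).eRk_closure_eq S]
      exact (algMatroid ℂ).eRk_mono hBS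
    have h2 : (algMatroid ℂ).eRk S < ⊤ :=
      lt_of_le_of_lt ((algMatroid ℂ).eRk_le_encard S) hS.encard_lt_top
    have h3 : (algMatroid ℂ).eRk B = ⊤ := by
      rw [hind.eRk_eq_encard, hBinf.encard_eq]
    rw [h3] at h1
    exact (lt_irrefl _) (lt_of_le_of_lt h1 h2)

/-- **The algebraic matroid of a subfield is the restriction of that of the field**: for
`Ω ≤ ℂ` and `S ⊆ Ω`, `acl_Ω S = Ω ∩ acl_ℂ S`. [folklore] -/
theorem acl_eq_preimage (Ω : Subfield ℂ) (S : Set Ω) :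
    acl S = ((↑) : Ω → ℂ) ⁻¹' acl (((↑) : Ω → ℂ) '' S) := by
  change (algMatroid Ω).closure S = _
  rw [show algMatroid Ω = (algMatroid ℂ).comap ((↑) : Ω → ℂ) from
    MatroidComap.algebraicIndependent_matroid_eq_comap Ω.subtype Subtype.val_injective,
    Matroid.comap_closure_eq]
  rfl

/-- **The ambient field, with room stated inside it**: a countable algebraically closed subfield
`Ω ⊆ ℂ` containing `2πi`, closed under `acl`, in which no finite set is spanning for the algebraic
matroid of `↥Ω`. [folklore] -/
theorem exists_ambient' :
    ∃ Ω : Subfield ℂ, Countable Ω ∧ IsAlgClosed Ω ∧ (2 * Real.pi * Complex.I : ℂ) ∈ Ω ∧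
      (∀ x : ℂ, x ∈ acl (Ω : Set ℂ) → x ∈ Ω) ∧
      (∀ S : Set Ω, S.Finite → ∃ t : Ω, t ∉ acl S) := by
  obtain ⟨Ω, h1, h2, h3, h4, h5⟩ := exists_ambient
  refine ⟨Ω, h1, h2, h3, h4, fun S hS => ?_⟩
  obtain ⟨t, htΩ, ht⟩ := h5 (((↑) : Ω → ℂ) '' S) (hS.image _)
  refine ⟨⟨t, htΩ⟩, ?_⟩
  rw [acl_eq_preimage, mem_preimage]
  exact ht

end PseudoExpAmbient

end Literature.NumberTheory.Transcendental
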